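import Literature.Analysis.FluidPDE.LinearisedNSFourierForcedTimeRegularity
import Literature.Analysis.FluidPDE.LinearisedNSFourierData
import HarnessLib

/-!
# Fourier-side data of the linearised Navier–Stokes equation with a source, for smooth data

Analysis/FluidPDE proof file, fifth of the files `LinearisedNSFourierForced*` (objects in
`LinearisedNSFourierForcedDefs`; the forced Picard limit and its time regularity in
`LinearisedNSFourierForcedIteration`, `LinearisedNSFourierForcedTimeRegularity`), the
inhomogeneous twin of `LinearisedNSFourierData`. For a background velocity `u` jointly smooth
and divergence free on `[0, T] × T^d`, a source `g` jointly smooth on `[0, T] × T^d` with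
mean-zero slices, and a smooth, divergence-free, mean-zero datum `w₀` (Constantin–Foias 1988,
Ch. 14, (14.3)–(14.4) with an inhomogeneity), the Fourier-side data
`U = CorrectorFourier.driftCoeff T u`, `G = CorrectorFourier.driftCoeff T g` (the coefficients
of the complexified components at clamped time — the source is a vector field of the same type
as the background, so the drift dictionary of `CorrectorFourierData` is reused verbatim) and
`a = datumCoeff w₀` satisfy:

* `driftCoeff_zero_freq` — the zero mode of the source coefficients vanishes,
  `Gₗ(t)(0) = ∫ gₗ(clamp t) = 0` (mean-zero slices; `datumCoeff_zero` at clamped time);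
* `picardHypF` — the hypotheses `PicardHypF ν T U G a` of the forced Picard iteration;
* `solCoeffF_spec` — the package of Fourier-side properties of the solution coefficients
  `c = solCoeffF ν T u g w₀` (continuity, every decay, divergence freedom, zero mode, the
  datum, the differentiated mild equation `∂ₜcₗ = -νₖcₗ - (P linSym)ₗ + (P G)ₗ` on `[0, T]`,
  coefficient families of every order);
* `exists_presFamilyF` — the pressure coefficients `presCoeffFieldF ν T u g w₀` start a
  coefficient family of every order (as `exists_presFamily`, with the extra source part
  `(∑ₘ kₘ Gₘ)/(2πi|k|²)`).

## References

* P. Constantin, C. Foias, *Navier–Stokes Equations*, Univ. Chicago Press 1988, Ch. 14, (14.3)–(14.4). [`ConstantinFoiasNSE1988`]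
* L. Grafakos, *Classical Fourier Analysis*, 3rd ed. (2014), Prop. 3.2.6 (8), §3.3.1. [`Grafakos2014`]
-/

noncomputable section

open MeasureTheory Real Set Filter Topology UnitAddTorus

namespace Literature.Analysis.FluidPDE

namespace LinearisedNSFourier

open ScalarFourier
open CorrectorFourier (leraySym compC driftFam driftCoeff driftCoeff_apply isCoeffFamily_driftFam
  driftFam_zero_of_mem sum_intCast_mul_driftCoeff norm_presSymbol_le norm_intCast_apply_le)
open FourierNS (HasDecay clamp)
open Literature.Analysis.FunctionSpaces.Torus (freqNormSq IsSmoothSpaceTimeOn IsSmooth)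

variable {d : Type*} [Fintype d] [DecidableEq d]
variable {ν T : ℝ} {u g : ℝ → UnitAddTorus d → EuclideanSpace ℝ d}
  {w₀ : UnitAddTorus d → EuclideanSpace ℝ d}

/-! ### The source: zero mode -/

omit [DecidableEq d] in
/-- **The zero mode of the source coefficients vanishes** for a source with mean-zero slices
on `[0, T]`: `Gₗ(t)(0) = ∫ gₗ(clamp t) = 0` (the clamped time lies in `[0, T]`;
`datumCoeff_zero` for the slice). [folklore] -/
theorem driftCoeff_zero_freq (hT : 0 ≤ T) (hg : IsSmoothSpaceTimeOn (Icc 0 T) g)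
    (hgmean : ∀ t ∈ Icc 0 T, FunctionSpaces.Torus.HasZeroMean (g t)) (l : d) (t : ℝ) :
    driftCoeff T g l t 0 = 0 := by
  have hs := FourierNS.clamp_mem_Icc hT t
  rw [driftCoeff_apply]
  exact datumCoeff_zero (w₀ := g (clamp T t)) (hg.isSmooth_slice hs) (hgmean _ hs) l

/-! ### The forced Picard hypotheses -/

/-- **The Fourier-side data of a smooth background, source and datum satisfy `PicardHypF`**
for `ν > 0`, `T > 0`: the homogeneous hypotheses are `picardHyp`; the source coefficients are
continuous in time at each frequency (the zeroth members of the source families are continuous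
on `[0, T]`, composed with the continuous clamp) and have every decay uniformly in time
(uniform on the compact `[0, T]`), exactly as the drift coefficients. [folklore] -/
theorem picardHypF (hν : 0 < ν) (hT : 0 < T) (hu : IsSmoothSpaceTimeOn (Icc 0 T) u)
    (hg : IsSmoothSpaceTimeOn (Icc 0 T) g) (hw₀ : IsSmooth w₀) :
    PicardHypF ν T (driftCoeff T u) (driftCoeff T g) (datumCoeff w₀) := by
  have hGFf : ∀ n j, IsCoeffFamily T n (driftFam T g j) := isCoeffFamily_driftFam hT hg
  refine ⟨picardHyp hν hT hu hw₀, fun j m => ?_, fun K => ?_⟩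
  · exact ((hGFf 0 j).cont 0 le_rfl m).comp_continuous (FourierNS.continuous_clamp T)
      fun t => FourierNS.clamp_mem_Icc hT.le t
  · have h1 : ∀ j, ∃ C : ℝ, 0 ≤ C ∧ ∀ t ∈ Icc 0 T, HasDecay K C (driftFam T g j 0 t) := fun j =>
      (hGFf 0 j).decay_nonneg le_rfl K
    choose C hC0 hC using h1
    refine ⟨∑ j, C j, fun j t => ((hC j _ (FourierNS.clamp_mem_Icc hT.le t)).mono ?_)⟩
    exact Finset.single_le_sum (fun i _ => hC0 i) (Finset.mem_univ j)

/-! ### The Fourier-side package of the solution coefficients -/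

/-- **The Fourier-side properties of `c = solCoeffF ν T u g w₀`** for `ν > 0`, `T > 0`, a
jointly smooth divergence-free background `u` on `[0, T] × T^d`, a jointly smooth source `g`
with mean-zero slices and a smooth divergence-free mean-zero datum `w₀`: continuity in time,
every decay uniformly in time, Fourier divergence freedom `∑ₗ kₗ c(l,t,k) = 0`, vanishing zero
mode `c(l,t,0) = 0`, the datum `c(l,0,k) = aₗ(k)`, the differentiated mild equation
`∂ₜcₗ = -νₖcₗ - (P linSym)ₗ + (P G)ₗ` within `[0, T]`, and coefficient families of every
order starting at `c`. [folklore] -/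
theorem solCoeffF_spec (hν : 0 < ν) (hT : 0 < T) (hu : IsSmoothSpaceTimeOn (Icc 0 T) u)
    (hdiv : ∀ t ∈ Icc 0 T, FunctionSpaces.Torus.IsDivFree (u t)) (hg : IsSmoothSpaceTimeOn (Icc 0 T) g)
    (hgmean : ∀ t ∈ Icc 0 T, FunctionSpaces.Torus.HasZeroMean (g t)) (hw₀ : IsSmooth w₀)
    (hw₀div : FunctionSpaces.Torus.IsDivFree w₀) (hw₀mean : FunctionSpaces.Torus.HasZeroMean w₀) :
    (∀ l m, Continuous fun t => solCoeffF ν T u g w₀ l t m) ∧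
    (∀ K : ℕ, ∃ C : ℝ, 0 ≤ C ∧ ∀ l t, HasDecay K C (solCoeffF ν T u g w₀ l t)) ∧
    (∀ t k, ∑ l, (k l : ℂ) * solCoeffF ν T u g w₀ l t k = 0) ∧
    (∀ l t, solCoeffF ν T u g w₀ l t 0 = 0) ∧
    (∀ l k, solCoeffF ν T u g w₀ l 0 k = datumCoeff w₀ l k) ∧
    (∀ l k, ∀ t ∈ Icc 0 T, HasDerivWithinAt (fun s => solCoeffF ν T u g w₀ l s k)
      (-(heatRate ν k : ℂ) * solCoeffF ν T u g w₀ l t k -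
        linProjSym (fun j => driftCoeff T u j t) (fun j => solCoeffF ν T u g w₀ j t) l k +
        srcProj (fun j => driftCoeff T g j t) l k) (Icc 0 T) t) ∧
    (∀ n : ℕ, ∃ W : d → ℕ → ℝ → (d → ℤ) → ℂ, (∀ l, W l 0 = solCoeffF ν T u g w₀ l) ∧
      ∀ l, IsCoeffFamily T n (W l)) := by
  have h := picardHypF hν hT hu hg hw₀
  have hadiv : ∀ k, ∑ l, (k l : ℂ) * datumCoeff w₀ l k = 0 := sum_intCast_mul_datumCoeff hw₀ hw₀div
  have ha0 : ∀ l, datumCoeff w₀ l 0 = 0 := datumCoeff_zero hw₀ hw₀mean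
  have hUdiv : ∀ t m, ∑ j, (m j : ℂ) * driftCoeff T u j t m = 0 := sum_intCast_mul_driftCoeff hT.le hu hdiv
  have hG0 : ∀ j s, driftCoeff T g j s 0 = 0 := fun j s => driftCoeff_zero_freq hT.le hg hgmean j s
  refine ⟨h.continuous_picardLimF, h.hasDecay_picardLimF, h.sum_intCast_mul_picardLimF hadiv,
    h.picardLimF_zero_freq ha0 hadiv hUdiv hG0, h.picardLimF_zero,
    fun l k t ht => h.hasDerivWithinAt_picardLimF l k ht, fun n => ?_⟩
  exact h.exists_coeffFamilyF (fun n j => isCoeffFamily_driftFam hT hu n j)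
    (fun j t ht => driftFam_zero_of_mem u j ht) (fun n j => isCoeffFamily_driftFam hT hg n j)
    (fun j t ht => driftFam_zero_of_mem g j ht) n

/-! ### The pressure family -/

/-- **The pressure coefficients start a coefficient family of every order.** With `W` the
velocity families of order `n`, the family `-(2πi|k|²)⁻¹ ∑ₘ kₘ (linFamilyₘ - GFₘ)` (`GF` the
source families) is a family of order `n` whose zeroth member agrees with
`presCoeffFieldF ν T u g w₀` on `[0, T]`; replacing the zeroth member by
`presCoeffFieldF ν T u g w₀` itself keeps it a family (adapted from `exists_presFamily`). [folklore] -/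
theorem exists_presFamilyF (hT : 0 < T) (hu : IsSmoothSpaceTimeOn (Icc 0 T) u)
    (hg : IsSmoothSpaceTimeOn (Icc 0 T) g) {n : ℕ}
    {W : d → ℕ → ℝ → (d → ℤ) → ℂ} (hW0 : ∀ l, W l 0 = solCoeffF ν T u g w₀ l)
    (hW : ∀ l, IsCoeffFamily T n (W l)) :
    ∃ Q : ℕ → ℝ → (d → ℤ) → ℂ, Q 0 = presCoeffFieldF ν T u g w₀ ∧ IsCoeffFamily T n Q := by
  have hUFf : ∀ j, IsCoeffFamily T n (driftFam T u j) := fun j => isCoeffFamily_driftFam hT hu n j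
  have hGFf : ∀ j, IsCoeffFamily T n (driftFam T g j) := fun j => isCoeffFamily_driftFam hT hg n j
  -- the candidate family
  set Q₀ : ℕ → ℝ → (d → ℤ) → ℂ := fun i t k =>
    (-(1 : ℂ)) / (2 * π * Complex.I * (freqNormSq k : ℂ)) *
      ∑ m, (k m : ℂ) * (linFamily (driftFam T u) W m i t k - driftFam T g m i t k) with hQ₀
  have hQ₀f : IsCoeffFamily T n Q₀ :=
    (IsCoeffFamily.finset_sum _ fun m _ =>
      ((IsCoeffFamily.linFamily hT hUFf hW m).sub (hGFf m)).symbol (σ := fun k => (k m : ℂ)) (g := 1)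
        zero_le_one (norm_intCast_apply_le m)).symbol (g := 0) zero_le_one norm_presSymbol_le
  -- agreement with `presCoeffFieldF` on `[0, T]`
  have hagree : ∀ t ∈ Icc 0 T, ∀ k, Q₀ 0 t k = presCoeffFieldF ν T u g w₀ t k := by
    intro t ht k
    simp only [hQ₀, linFamily_zero, presCoeffFieldF_apply, presCoefF_apply, hW0]
    have hU' : (fun j => driftFam T u j 0 t) = fun j => driftCoeff T u j t :=
      funext fun j => driftFam_zero_of_mem u j ht
    have hG' : ∀ m, driftFam T g m 0 t k = driftCoeff T g m t k := fun m => by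
      rw [driftFam_zero_of_mem g m ht]
    simp only [hU', hG']
    ring
  -- replace the zeroth member
  refine ⟨fun i => if i = 0 then presCoeffFieldF ν T u g w₀ else Q₀ i, by simp, ?_⟩
  refine ⟨fun i hi K => ?_, fun i hi m => ?_, fun i hi m t ht => ?_⟩
  · obtain ⟨C, hC⟩ := hQ₀f.decay i hi K
    refine ⟨C, fun t ht m => ?_⟩
    split_ifs with h0
    · subst h0; rw [← hagree t ht m]; exact hC t ht m
    · exact hC t ht m
  · split_ifs with h0
    · subst h0
      exact (hQ₀f.cont 0 hi m).congr fun t ht => (hagree t ht m).symm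
    · exact hQ₀f.cont i hi m
  · have hd := hQ₀f.deriv i hi m t ht
    have hne : i + 1 ≠ 0 := Nat.succ_ne_zero i
    simp only [hne, if_false]
    split_ifs with h0
    · subst h0
      exact hd.congr (fun s hs => (hagree s hs m).symm) (hagree t ht m).symm
    · exact hd

end LinearisedNSFourier

end Literature.Analysis.FluidPDE

end
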